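import Literature.RepresentationTheory.Kovacevic2021.SU21ModulesFromKTypes
import HarnessLib

/-!
# Gauge equivalence of Kovačević's `K`-type data for `SU(2,1)`: rescaling the `K`-types is an
# isomorphism of `𝔤𝔩(3,ℂ)`-modules

Continuation of `Literature.RepresentationTheory.Kovacevic2021.SU21ModulesFromKTypes` (a datum
`𝒟 : SU21Datum` — `K`-types `S` and arrow coefficients `A, B, C, D` — carries the `𝔤𝔩(3,ℂ)`-module `𝒟.V`
with basis `u^k_{n,m}`).

[Kovacevic2021, §3 Remark 3] (held text `paper:arxiv-1810.01752` p0006): "It follows from relations (b20)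
and (b25) that products `a_{nm}d_{n+1,m+3}` and `b_{nm}c_{n+1,m-3}` are uniquely determined, but coefficients
`a_{nm}, b_{nm}, c_{nm}` and `d_{nm}` are not. We usualy choose `a_{nm}=1` (or `d_{nm}=1`) …".  The freedom is
a **gauge**: rescaling the basis of each `K`-type, `u^k_{n,m} ↦ g_{n,m} u^k_{n,m}` (`g_{n,m} ≠ 0`, the same factor
for all `k` so that the `𝔨`-action is untouched), replaces `A_{n,m}` by `A_{n,m} g_{n,m}/g_{n+1,m+3}`, …, and
does not change the module.  This file makes that precise: two data `𝒟₁`, `𝒟₂` with the same `K`-types whose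
coefficients are related by a nowhere-zero gauge `g` (`A₁ g' = g A₂` on every arrow landing in a `K`-type, and
likewise for `B, C, D`) have ISOMORPHIC `𝔤𝔩(3,ℂ)`-modules: `gaugeEquiv : 𝒟₁.V ≃ₗ⁅ℂ, 𝔤𝔩₃⁆ 𝒟₂.V`,
`u^k_{n,m} ↦ g_{n,m} u^k_{n,m}`.  (Arrows landing outside `S` carry no condition: their coefficients never enter
the action, the target basis vector being `0`.)  Used by `SU21GaugeExistence` to identify an irreducible
cohomological datum with one of the six model modules up to isomorphism.

## What is here

* DEFINITIONS with bodies: `gaugeMap 𝒟₁ 𝒟₂ g : 𝒟₁.V →ₗ[ℂ] 𝒟₂.V` (`u^k_{n,m} ↦ g_{n,m} u^k_{n,m}`), `gaugeHom`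
  (the same as a Lie module homomorphism under the gauge conditions), `gaugeEquiv` (the Lie module
  isomorphism when `g ≠ 0` on `S`);
* THEOREMS: `gaugeMap_vec`, the eight intertwining identities `gaugeMap_Ha`, …, `gaugeMap_Yab`,
  `gaugeMap_lie`, `gaugeMap_comp_inv`, `gaugeEquiv_vec`.

## References

* D. Kovačević, *Unitary `(𝔤,K)` modules of `SU(2,1)`*, Acta Math. Spalatensia 1 (2021) 105–125
  (arXiv:1810.01752): §3 Thm 1, Thm 2, Remark 3. [Kovacevic2021]
* A. Borel, N. Wallach (2000), VI 4.8–4.11 (context). [BorelWallach2000]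
-/

noncomputable section

open Finsupp

namespace Literature.RepresentationTheory.Kovacevic2021

-- Mathlib idiom (Mathlib/Algebra/Lie/OfAssociative.lean): commutator brackets on associative algebras; needed for
-- the `𝔤𝔩(3,ℂ)`-module structure on `𝒟.V`, as in every file of this directory.
attribute [local instance 100] LieRing.ofAssociativeRing

namespace SU21Datum

/-- **The gauge map** `u^k_{n,m} ↦ g_{n,m} u^k_{n,m}` between the modules of two data.
[cite: Kovacevic2021, §3 Remark 3] -/
def gaugeMap (𝒟₁ 𝒟₂ : SU21Datum) (g : ℤ → ℤ → ℂ) : 𝒟₁.V →ₗ[ℂ] 𝒟₂.V :=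
  Finsupp.linearCombination ℂ fun t : 𝒟₁.Idx => g t.1.1 t.1.2.1 • 𝒟₂.vec t.1.1 t.1.2.1 t.1.2.2

variable {𝒟₁ 𝒟₂ : SU21Datum}

/-- the gauge map on the basis (same `K`-types): `u^k_{n,m} ↦ g_{n,m} u^k_{n,m}` for ALL labels (both sides
vanish off the admissible ones). [cite: Kovacevic2021, §3 Remark 3] -/
theorem gaugeMap_vec (hS : 𝒟₁.S = 𝒟₂.S) (g : ℤ → ℤ → ℂ) (n m k : ℤ) :
    gaugeMap 𝒟₁ 𝒟₂ g (𝒟₁.vec n m k) = g n m • 𝒟₂.vec n m k := by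
  by_cases h : (n, m) ∈ 𝒟₁.S ∧ 1 ≤ k ∧ k ≤ n
  · rw [vec_of_pos n m k h, gaugeMap, Finsupp.linearCombination_single, one_smul]
  · rw [vec_of_neg n m k h, map_zero, vec_of_neg n m k (by rwa [← hS]), smul_zero]

/-- two multiples of a basis vector of `𝒟₂` agree as soon as the scalars agree WHEN the label is a `K`-type
[cite: Kovacevic2021, §3 Def 1] -/
private theorem smul_vec_congr (hS : 𝒟₁.S = 𝒟₂.S) {n m k : ℤ} {a b : ℂ} (h : (n, m) ∈ 𝒟₁.S → a = b) :
    a • 𝒟₂.vec n m k = b • 𝒟₂.vec n m k := by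
  by_cases hn : (n, m) ∈ 𝒟₁.S
  · rw [h hn]
  · rw [vec_of_not_mem k (show (n, m) ∉ 𝒟₂.S by rwa [← hS]), smul_zero, smul_zero]

/-! ## The eight intertwining identities -/

section Intertwining

variable (hS : 𝒟₁.S = 𝒟₂.S) (g : ℤ → ℤ → ℂ)
  (hA : ∀ n m : ℤ, (n + 1, m + 3) ∈ 𝒟₁.S → 𝒟₁.A n m * g (n + 1) (m + 3) = g n m * 𝒟₂.A n m)
  (hB : ∀ n m : ℤ, (n + 1, m - 3) ∈ 𝒟₁.S → 𝒟₁.B n m * g (n + 1) (m - 3) = g n m * 𝒟₂.B n m)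
  (hC : ∀ n m : ℤ, (n - 1, m + 3) ∈ 𝒟₁.S → 𝒟₁.C n m * g (n - 1) (m + 3) = g n m * 𝒟₂.C n m)
  (hD : ∀ n m : ℤ, (n - 1, m - 3) ∈ 𝒟₁.S → 𝒟₁.D n m * g (n - 1) (m - 3) = g n m * 𝒟₂.D n m)

include hS

/-- the gauge map commutes with `H_α` (diagonal, gauge-independent) [cite: Kovacevic2021, §3 Def 1] -/
theorem gaugeMap_Ha : gaugeMap 𝒟₁ 𝒟₂ g ∘ₗ 𝒟₁.Ha = 𝒟₂.Ha ∘ₗ gaugeMap 𝒟₁ 𝒟₂ g := by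
  refine ext_vec fun n m k _ _ _ => ?_
  simp only [LinearMap.comp_apply, Ha_vec, map_smul, gaugeMap_vec hS, smul_smul]
  congr 1
  ring

/-- the gauge map commutes with `H_β` [cite: Kovacevic2021, §3 Def 1] -/
theorem gaugeMap_Hb : gaugeMap 𝒟₁ 𝒟₂ g ∘ₗ 𝒟₁.Hb = 𝒟₂.Hb ∘ₗ gaugeMap 𝒟₁ 𝒟₂ g := by
  refine ext_vec fun n m k _ _ _ => ?_
  simp only [LinearMap.comp_apply, Hb_vec, map_smul, gaugeMap_vec hS, smul_smul]
  congr 1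
  ring

/-- the gauge map commutes with `X_α` [cite: Kovacevic2021, §3 Def 1] -/
theorem gaugeMap_Xa : gaugeMap 𝒟₁ 𝒟₂ g ∘ₗ 𝒟₁.Xa = 𝒟₂.Xa ∘ₗ gaugeMap 𝒟₁ 𝒟₂ g := by
  refine ext_vec fun n m k _ _ _ => ?_
  simp only [LinearMap.comp_apply, Xa_vec, map_smul, gaugeMap_vec hS, smul_smul]
  congr 1
  ring

/-- the gauge map commutes with `Y_α` [cite: Kovacevic2021, §3 Def 1] -/
theorem gaugeMap_Ya : gaugeMap 𝒟₁ 𝒟₂ g ∘ₗ 𝒟₁.Ya = 𝒟₂.Ya ∘ₗ gaugeMap 𝒟₁ 𝒟₂ g := by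
  refine ext_vec fun n m k _ hk _ => ?_
  simp only [LinearMap.comp_apply, Ya_vec n m hk, map_neg, map_smul, gaugeMap_vec hS, smul_neg]

include hA hC in
/-- the gauge map commutes with `X_{α+β}` (gauge conditions for `A` and `C`) [cite: Kovacevic2021, §3 Thm 1, Remark 3] -/
theorem gaugeMap_Xab : gaugeMap 𝒟₁ 𝒟₂ g ∘ₗ 𝒟₁.Xab = 𝒟₂.Xab ∘ₗ gaugeMap 𝒟₁ 𝒟₂ g := by
  refine ext_vec fun n m k _ _ _ => ?_
  simp only [LinearMap.comp_apply, Xab_vec, map_add, map_smul, gaugeMap_vec hS, smul_add, smul_smul]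
  congr 1
  · exact smul_vec_congr hS fun h => by linear_combination ((n : ℂ) + 1 - k) * hA n m h
  · exact smul_vec_congr hS fun h => by linear_combination ((k : ℂ) - 1) * hC n m h

include hA hC in
/-- the gauge map commutes with `X_β` [cite: Kovacevic2021, §3 Thm 1, Remark 3] -/
theorem gaugeMap_Xb : gaugeMap 𝒟₁ 𝒟₂ g ∘ₗ 𝒟₁.Xb = 𝒟₂.Xb ∘ₗ gaugeMap 𝒟₁ 𝒟₂ g := by
  refine ext_vec fun n m k _ hk _ => ?_
  simp only [LinearMap.comp_apply, Xb_vec n m hk, map_add, map_smul, gaugeMap_vec hS, smul_add, smul_smul]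
  congr 1
  · exact smul_vec_congr hS fun h => by linear_combination (-1 : ℂ) * hA n m h
  · exact smul_vec_congr hS fun h => by linear_combination hC n m h

include hB hD in
/-- the gauge map commutes with `Y_{α+β}` (gauge conditions for `B` and `D`) [cite: Kovacevic2021, §3 Thm 1, Remark 3] -/
theorem gaugeMap_Yab : gaugeMap 𝒟₁ 𝒟₂ g ∘ₗ 𝒟₁.Yab = 𝒟₂.Yab ∘ₗ gaugeMap 𝒟₁ 𝒟₂ g := by
  refine ext_vec fun n m k _ hk _ => ?_
  simp only [LinearMap.comp_apply, Yab_vec n m hk, map_add, map_smul, gaugeMap_vec hS, smul_add, smul_smul]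
  congr 1
  · exact smul_vec_congr hS fun h => by linear_combination hB n m h
  · exact smul_vec_congr hS fun h => by linear_combination hD n m h

include hB hD in
/-- the gauge map commutes with `Y_β` [cite: Kovacevic2021, §3 Thm 1, Remark 3] -/
theorem gaugeMap_Yb : gaugeMap 𝒟₁ 𝒟₂ g ∘ₗ 𝒟₁.Yb = 𝒟₂.Yb ∘ₗ gaugeMap 𝒟₁ 𝒟₂ g := by
  refine ext_vec fun n m k _ _ _ => ?_
  simp only [LinearMap.comp_apply, Yb_vec, map_add, map_smul, gaugeMap_vec hS, smul_add, smul_smul]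
  congr 1
  · exact smul_vec_congr hS fun h => by linear_combination ((n : ℂ) + 1 - k) * hB n m h
  · exact smul_vec_congr hS fun h => by linear_combination (-((k : ℂ) - 1)) * hD n m h

include hA hB hC hD in
/-- **The gauge map intertwines the `𝔤𝔩(3,ℂ)`-actions.** [cite: Kovacevic2021, §3 Thm 1, Thm 2, Remark 3] -/
theorem gaugeMap_lie (M : Matrix (Fin 3) (Fin 3) ℂ) (v : 𝒟₁.V) :
    gaugeMap 𝒟₁ 𝒟₂ g ⁅M, v⁆ = ⁅M, gaugeMap 𝒟₁ 𝒟₂ g v⁆ := by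
  have e : ∀ (T₁ : Module.End ℂ 𝒟₁.V) (T₂ : Module.End ℂ 𝒟₂.V),
      gaugeMap 𝒟₁ 𝒟₂ g ∘ₗ T₁ = T₂ ∘ₗ gaugeMap 𝒟₁ 𝒟₂ g → gaugeMap 𝒟₁ 𝒟₂ g (T₁ v) = T₂ (gaugeMap 𝒟₁ 𝒟₂ g v) :=
    fun T₁ T₂ h => by rw [← LinearMap.comp_apply, h, LinearMap.comp_apply]
  rw [lie_def, lie_def]
  simp only [ρfun, LinearMap.add_apply, LinearMap.smul_apply, map_add, map_smul,
    e _ _ (gaugeMap_Ha hS g), e _ _ (gaugeMap_Hb hS g), e _ _ (gaugeMap_Xa hS g), e _ _ (gaugeMap_Ya hS g),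
    e _ _ (gaugeMap_Xab hS g hA hC), e _ _ (gaugeMap_Xb hS g hA hC), e _ _ (gaugeMap_Yab hS g hB hD),
    e _ _ (gaugeMap_Yb hS g hB hD)]

end Intertwining

/-- **Gauge maps compose**: rescaling by `g` after rescaling by `g⁻¹` is the identity (on the basis vectors of
the `K`-types, where `g ≠ 0`). [cite: Kovacevic2021, §3 Remark 3] -/
theorem gaugeMap_comp_inv (hS : 𝒟₁.S = 𝒟₂.S) (g : ℤ → ℤ → ℂ) (hg : ∀ n m : ℤ, (n, m) ∈ 𝒟₁.S → g n m ≠ 0) :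
    gaugeMap 𝒟₁ 𝒟₂ g ∘ₗ gaugeMap 𝒟₂ 𝒟₁ (fun n m => (g n m)⁻¹) = LinearMap.id := by
  refine ext_vec fun n m k hn _ _ => ?_
  simp only [LinearMap.comp_apply, gaugeMap_vec hS.symm, map_smul, gaugeMap_vec hS, smul_smul,
    LinearMap.id_apply]
  rw [inv_mul_cancel₀ (hg n m (by rwa [hS])), one_smul]

/-- the other composite [cite: Kovacevic2021, §3 Remark 3] -/
theorem gaugeMap_inv_comp (hS : 𝒟₁.S = 𝒟₂.S) (g : ℤ → ℤ → ℂ) (hg : ∀ n m : ℤ, (n, m) ∈ 𝒟₁.S → g n m ≠ 0) :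
    gaugeMap 𝒟₂ 𝒟₁ (fun n m => (g n m)⁻¹) ∘ₗ gaugeMap 𝒟₁ 𝒟₂ g = LinearMap.id := by
  refine ext_vec fun n m k hn _ _ => ?_
  simp only [LinearMap.comp_apply, gaugeMap_vec hS, map_smul, gaugeMap_vec hS.symm, smul_smul,
    LinearMap.id_apply]
  rw [mul_inv_cancel₀ (hg n m hn), one_smul]

/-- **The gauge map as a homomorphism of `𝔤𝔩(3,ℂ)`-modules** (under the gauge conditions on every arrow
landing in a `K`-type). [cite: Kovacevic2021, §3 Thm 2, Remark 3] -/
def gaugeHom (𝒟₁ 𝒟₂ : SU21Datum) (g : ℤ → ℤ → ℂ) (hS : 𝒟₁.S = 𝒟₂.S)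
    (hA : ∀ n m : ℤ, (n + 1, m + 3) ∈ 𝒟₁.S → 𝒟₁.A n m * g (n + 1) (m + 3) = g n m * 𝒟₂.A n m)
    (hB : ∀ n m : ℤ, (n + 1, m - 3) ∈ 𝒟₁.S → 𝒟₁.B n m * g (n + 1) (m - 3) = g n m * 𝒟₂.B n m)
    (hC : ∀ n m : ℤ, (n - 1, m + 3) ∈ 𝒟₁.S → 𝒟₁.C n m * g (n - 1) (m + 3) = g n m * 𝒟₂.C n m)
    (hD : ∀ n m : ℤ, (n - 1, m - 3) ∈ 𝒟₁.S → 𝒟₁.D n m * g (n - 1) (m - 3) = g n m * 𝒟₂.D n m) :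
    𝒟₁.V →ₗ⁅ℂ, Matrix (Fin 3) (Fin 3) ℂ⁆ 𝒟₂.V :=
  { gaugeMap 𝒟₁ 𝒟₂ g with
    map_lie' := fun {M v} => gaugeMap_lie hS g hA hB hC hD M v }

/-- **Gauge equivalence.** Two data with the same `K`-types whose arrow coefficients differ by a nowhere-zero
gauge `g` (`A₁ g_{n+1,m+3} = g_{n,m} A₂`, `B₁ g_{n+1,m-3} = g_{n,m} B₂`, `C₁ g_{n-1,m+3} = g_{n,m} C₂`,
`D₁ g_{n-1,m-3} = g_{n,m} D₂` on every arrow landing in a `K`-type) have isomorphic `𝔤𝔩(3,ℂ)`-modules: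
`u^k_{n,m} ↦ g_{n,m} u^k_{n,m}`. [cite: Kovacevic2021, §3 Thm 2, Remark 3] -/
def gaugeEquiv (𝒟₁ 𝒟₂ : SU21Datum) (g : ℤ → ℤ → ℂ) (hS : 𝒟₁.S = 𝒟₂.S)
    (hg : ∀ n m : ℤ, (n, m) ∈ 𝒟₁.S → g n m ≠ 0)
    (hA : ∀ n m : ℤ, (n + 1, m + 3) ∈ 𝒟₁.S → 𝒟₁.A n m * g (n + 1) (m + 3) = g n m * 𝒟₂.A n m)
    (hB : ∀ n m : ℤ, (n + 1, m - 3) ∈ 𝒟₁.S → 𝒟₁.B n m * g (n + 1) (m - 3) = g n m * 𝒟₂.B n m)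
    (hC : ∀ n m : ℤ, (n - 1, m + 3) ∈ 𝒟₁.S → 𝒟₁.C n m * g (n - 1) (m + 3) = g n m * 𝒟₂.C n m)
    (hD : ∀ n m : ℤ, (n - 1, m - 3) ∈ 𝒟₁.S → 𝒟₁.D n m * g (n - 1) (m - 3) = g n m * 𝒟₂.D n m) :
    𝒟₁.V ≃ₗ⁅ℂ, Matrix (Fin 3) (Fin 3) ℂ⁆ 𝒟₂.V :=
  { gaugeHom 𝒟₁ 𝒟₂ g hS hA hB hC hD with
    invFun := gaugeMap 𝒟₂ 𝒟₁ (fun n m => (g n m)⁻¹)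
    left_inv := fun v => by
      change (gaugeMap 𝒟₂ 𝒟₁ (fun n m => (g n m)⁻¹) ∘ₗ gaugeMap 𝒟₁ 𝒟₂ g) v = v
      rw [gaugeMap_inv_comp hS g hg, LinearMap.id_apply]
    right_inv := fun w => by
      change (gaugeMap 𝒟₁ 𝒟₂ g ∘ₗ gaugeMap 𝒟₂ 𝒟₁ (fun n m => (g n m)⁻¹)) w = w
      rw [gaugeMap_comp_inv hS g hg, LinearMap.id_apply] }

/-- the gauge equivalence on the basis: `u^k_{n,m} ↦ g_{n,m} u^k_{n,m}` [cite: Kovacevic2021, §3 Remark 3] -/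
theorem gaugeEquiv_vec (hS : 𝒟₁.S = 𝒟₂.S) (g : ℤ → ℤ → ℂ) (hg : ∀ n m : ℤ, (n, m) ∈ 𝒟₁.S → g n m ≠ 0)
    (hA : ∀ n m : ℤ, (n + 1, m + 3) ∈ 𝒟₁.S → 𝒟₁.A n m * g (n + 1) (m + 3) = g n m * 𝒟₂.A n m)
    (hB : ∀ n m : ℤ, (n + 1, m - 3) ∈ 𝒟₁.S → 𝒟₁.B n m * g (n + 1) (m - 3) = g n m * 𝒟₂.B n m)
    (hC : ∀ n m : ℤ, (n - 1, m + 3) ∈ 𝒟₁.S → 𝒟₁.C n m * g (n - 1) (m + 3) = g n m * 𝒟₂.C n m)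
    (hD : ∀ n m : ℤ, (n - 1, m - 3) ∈ 𝒟₁.S → 𝒟₁.D n m * g (n - 1) (m - 3) = g n m * 𝒟₂.D n m)
    (n m k : ℤ) :
    gaugeEquiv 𝒟₁ 𝒟₂ g hS hg hA hB hC hD (𝒟₁.vec n m k) = g n m • 𝒟₂.vec n m k :=
  gaugeMap_vec hS g n m k

end SU21Datum

end Literature.RepresentationTheory.Kovacevic2021
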